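import Summits.Ventures.LatticeQCDFlow.Scoring.TorusFreeEnergyAnalytic2D
import Summits.Ventures.LatticeQCDFlow.Scoring.PlaquetteVarianceWeakCoupling
import Summits.Ventures.LatticeQCDFlow.Scoring.PlaquetteVarianceWeakCouplingSU
import HarnessLib

/-!
# The specific heat of two-dimensional `U(N)` and `SU(N)` lattice Yang–Mills at weak coupling: `β² f″(β) → dim G / 2` for every `N`

HONEST FRAMING: exact (Metropolis-corrected) sampling algorithms for lattice gauge theory;
figures of merit are autocorrelation/cost numbers at stated couplings and volumes; no
continuum-physics claim.

Venture `LatticeQCDFlow` (cell pub-lqcd), sub-topic `Scoring`; FANOUT row 5 (`s0-sun-a`), GEN-20.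
NEW WORK of the cell (placement rule).  GEN-19 (27) `TorusFreeEnergyAnalytic2D` identified the free energy density of the
2-d theory in the Literature's `LatticeGaugeDLR` vocabulary, `f(β) = freeEnergyDensity 2 ρ β`, with `f = −Nβ + log det[I_{|i−j|}]`
for `U(N)` and `f = −Nβ + log Σ_q det[I_{|q+i−j|}]` for `SU(N)`; `f″(β)` is the tilted variance of the plaquette action (the
"specific heat per plaquette", `C(β) = β² f″(β)` in the lattice normalisation).  With GEN-20's equipartition laws
(`PlaquetteVarianceWeakCoupling{,SU}`):

* `iteratedDeriv_two_freeEnergyDensity_two_unitary_eq` / `…_specialUnitary_eq` — the linear term drops out of `f″`;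
* **`tendsto_sq_mul_iteratedDeriv_two_freeEnergyDensity_two_unitary`** — `β² f″_{U(N)}(β) → N²/2` (every `N`);
* **`tendsto_sq_mul_iteratedDeriv_two_freeEnergyDensity_two_specialUnitary`** — `β² f″_{SU(N)}(β) → (N² − 1)/2` (every `N ≥ 1`);
  `SU(2)`: `3/2`, `SU(3)`: `4` (`…_specialUnitary_three`).

That is: in `d = 2` each of the `dim G` Gaussian modes per plaquette contributes `1/2` to `β² f″` in the weak-coupling limit
(classical equipartition), exactly, for every `N`.  No `def`, nothing cited as a fact, 0 sorry.
-/

noncomputable section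

open Real MeasureTheory Filter Topology Finset
open Literature.MathematicalPhysics.QuantumFieldTheory (haarProbability)
open Literature.MathematicalPhysics.QuantumLattice (fundamentalRep unitaryFundamentalRep)
open Literature.Analysis.FunctionSpaces (besselI)
open Literature.RepresentationTheory.CompactGroups

namespace Summit.Ventures.LatticeQCDFlow.Scoring

/-- Second derivative of `β ↦ −Nβ + L(β)` is `L″(β)` when `L` is differentiable everywhere. -/
theorem iteratedDeriv_two_neg_mul_add {L : ℝ → ℝ} {c : ℝ} (hL : ∀ x, DifferentiableAt ℝ L x) (β : ℝ) :
    iteratedDeriv 2 (fun x : ℝ => -(c * x) + L x) β = iteratedDeriv 2 L β := by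
  rw [iteratedDeriv_succ, iteratedDeriv_one, iteratedDeriv_succ, iteratedDeriv_one]
  have hd : deriv (fun x : ℝ => -(c * x) + L x) = fun x => -c + deriv L x := by
    funext x
    have h := (((hasDerivAt_id x).const_mul c).neg).add (hL x).hasDerivAt
    simp only [mul_one] at h
    exact h.deriv
  rw [hd, deriv_const_add]

/-- **`U(N)`**: `f″ = (log det[I_{|i−j|}])″`. -/
theorem iteratedDeriv_two_freeEnergyDensity_two_unitary_eq (N : ℕ) (β : ℝ) :
    iteratedDeriv 2 (fun β : ℝ =>
        Literature.MathematicalPhysics.QuantumLattice.freeEnergyDensity 2 (unitaryFundamentalRep (Fin N) ℂ) β) β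
      = iteratedDeriv 2 (fun y : ℝ => Real.log (Matrix.of fun i j : Fin N => besselI ((i : ℤ) - (j : ℤ)).natAbs y).det) β := by
  have hf : (fun β : ℝ => Literature.MathematicalPhysics.QuantumLattice.freeEnergyDensity 2
      (unitaryFundamentalRep (Fin N) ℂ) β) = fun β : ℝ =>
        -(N * β) + Real.log (Matrix.of fun i j : Fin N => besselI ((i : ℤ) - (j : ℤ)).natAbs β).det :=
    funext (freeEnergyDensity_two_unitary_eq N)
  rw [hf]
  exact iteratedDeriv_two_neg_mul_add (fun x =>
    ((hasDerivAt_det_besselI_toeplitz N x).log (det_besselI_toeplitz_fin_pos N x).ne').differentiableAt) β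

/-- **THE SPECIFIC HEAT OF 2-d `U(N)` LATTICE YANG–MILLS AT WEAK COUPLING: `β² f″(β) → N²/2 = dim U(N)/2`**, every `N`. -/
theorem tendsto_sq_mul_iteratedDeriv_two_freeEnergyDensity_two_unitary (N : ℕ) :
    Tendsto (fun β : ℝ => β ^ 2 * iteratedDeriv 2 (fun β : ℝ =>
        Literature.MathematicalPhysics.QuantumLattice.freeEnergyDensity 2 (unitaryFundamentalRep (Fin N) ℂ) β) β)
      atTop (𝓝 ((N : ℝ) ^ 2 / 2)) := by
  simp_rw [iteratedDeriv_two_freeEnergyDensity_two_unitary_eq]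
  exact tendsto_sq_mul_iteratedDeriv_two_log_det_besselI_toeplitz N

/-- **`SU(N)`**: `f″ = (log Σ_q det[I_{|q+i−j|}])″`. -/
theorem iteratedDeriv_two_freeEnergyDensity_two_specialUnitary_eq (N : ℕ) [NeZero N] (β : ℝ) :
    iteratedDeriv 2 (fun β : ℝ =>
        Literature.MathematicalPhysics.QuantumLattice.freeEnergyDensity 2 (fundamentalRep (Fin N)) β) β
      = iteratedDeriv 2 (fun y : ℝ =>
        Real.log (∑' q : ℤ, (Matrix.of fun i j : Fin N => besselI (q + (i : ℤ) - (j : ℤ)).natAbs y).det)) β := by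
  have hf : (fun β : ℝ => Literature.MathematicalPhysics.QuantumLattice.freeEnergyDensity 2
      (fundamentalRep (Fin N)) β) = fun β : ℝ =>
        -(N * β) + Real.log (∑' q : ℤ, (Matrix.of fun i j : Fin N => besselI (q + (i : ℤ) - (j : ℤ)).natAbs β).det) :=
    funext (freeEnergyDensity_two_specialUnitary_eq N)
  rw [hf]
  exact iteratedDeriv_two_neg_mul_add (fun x =>
    ((hasDerivAt_tsum_det_besselI N x).log (tsum_det_besselI_fin_pos N x).ne').differentiableAt) β

/-- **THE SPECIFIC HEAT OF 2-d `SU(N)` LATTICE YANG–MILLS AT WEAK COUPLING: `β² f″(β) → (N² − 1)/2 = dim SU(N)/2`**,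
every `N ≥ 1`. -/
theorem tendsto_sq_mul_iteratedDeriv_two_freeEnergyDensity_two_specialUnitary (N : ℕ) [NeZero N] :
    Tendsto (fun β : ℝ => β ^ 2 * iteratedDeriv 2 (fun β : ℝ =>
        Literature.MathematicalPhysics.QuantumLattice.freeEnergyDensity 2 (fundamentalRep (Fin N)) β) β)
      atTop (𝓝 (((N : ℝ) ^ 2 - 1) / 2)) := by
  simp_rw [iteratedDeriv_two_freeEnergyDensity_two_specialUnitary_eq]
  exact tendsto_sq_mul_iteratedDeriv_two_log_tsum_det_besselI N

/-- **`SU(3)`**: `β² f″(β) → 4`. -/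
theorem tendsto_sq_mul_iteratedDeriv_two_freeEnergyDensity_two_specialUnitary_three :
    Tendsto (fun β : ℝ => β ^ 2 * iteratedDeriv 2 (fun β : ℝ =>
        Literature.MathematicalPhysics.QuantumLattice.freeEnergyDensity 2 (fundamentalRep (Fin 3)) β) β)
      atTop (𝓝 4) := by
  have h := tendsto_sq_mul_iteratedDeriv_two_freeEnergyDensity_two_specialUnitary 3
  norm_num at h
  exact h

end Summit.Ventures.LatticeQCDFlow.Scoring
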